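import Summits.AtomisticToContinuum.HydrodynamicLimit.Theorems.JParityClosureLocalSecondLawLedgerObsCont
import Summits.AtomisticToContinuum.HydrodynamicLimit.Theorems.JParityClosureLocalSecondLawLedgerInner
import Summits.AtomisticToContinuum.HydrodynamicLimit.Theorems.JParityClosureLocalSecondLawCollisionalWorkRegularity

/-!
# Entropy ledger for `JParityClosure.LocalSecondLaw` — the entropy jump at a collision, I: convexity
(stmt-AtomisticToContinuum-13081, line `exact-entropy-ledger-three-passivities`, layer 14 of stub L)

At a collision time `t ∈ (0, τ]` of a regular good orbit, with colliding ordered pair `(i, j)`: the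
pre-collisional configuration `Φₜz⁻ = leftLim Φ.z t` has the same positions, the same velocities except
`vᵢ⁺ - vᵢ⁻ = a n̂`, `vⱼ⁺ - vⱼ⁻ = -a n̂` (`a = impulse`, `n̂ = nrm`, sibling file `CollisionalWorkRegularity`), so
`ρ_r⁻ = ρ_r⁺`, `m_r⁺ - m_r⁻ = (N+1)⁻¹ (bᵢ - bⱼ) a n̂`, `e_r⁺ - e_r⁻ = (N+1)⁻¹ (bᵢ - bⱼ) a ⟨n̂, vᵢ⁺ + vᵢ⁻⟩/2`, and it is
again in the regular range (temperature floor by passing to the limit `s ↑ t`).  Expanding the entropy about the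
POST-collisional state, the supporting-hyperplane inequality of the convex map `(m, e) ↦ H(ρ, θ(ρ, m, e))`
(layer 2) and `φ ≥ 0` bound the jump of the observable:
`F(t, Φₜz) - F(t, Φₜz⁻) ≤ (N+1)⁻¹ a ∫ G (bᵢ - bⱼ)`, `G = (φ/θ_r)(n̂·u_r - n̂·(vᵢ⁺+vᵢ⁻)/2)`.

References: H. B. Callen, *Thermodynamics* (1985) §8.1 (concavity of entropy); R. J. Hardy, J. Chem. Phys. 76
(1982) 622.
-/

noncomputable section

namespace Summit.AtomisticToContinuum.HydrodynamicLimit.Theorems.LocalSecondLawLedger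

open scoped BigOperators Topology ENNReal InnerProductSpace NNReal
open Filter Set MeasureTheory Function
open Literature.MathematicalPhysics.KineticTheory
open Literature.Analysis.FluidPDE
open Literature.Analysis.FunctionSpaces
open Summit.AtomisticToContinuum.HydrodynamicLimit.Theorems.LocalSecondLawNegative

namespace L

variable {N : ℕ}

section Collision

variable {σ : ℝ} (Φ : Flow σ N) {z : Phase N} (hz : z ∈ Φ.good) {t : ℝ} {i j : Fin (N + 1)} (hij : i ≠ j)
  (hct : ‖(Torus.geometry (Fin 3)).sepVec (Φ.flow t z i).1 (Φ.flow t z j).1‖ = hsDiameter σ N)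
include hz hij hct

/-- Velocities of the left limit: the pair jumps by `± a n̂`, the others do not jump. [folklore] -/
theorem vel_leftLim_eq (p : Fin (N + 1)) :
    (leftLim (fun s => Φ.flow s z) t p).2 = (Φ.flow t z p).2
      - (if p = i then impulse (hsDiameter σ N) (Φ.flow t z) i j • nrm (hsDiameter σ N) (Φ.flow t z) i j else 0)
      + (if p = j then impulse (hsDiameter σ N) (Φ.flow t z) i j • nrm (hsDiameter σ N) (Φ.flow t z) i j else 0) := by
  by_cases hpi : p = i
  · subst hpi
    rw [if_pos rfl, if_neg hij]
    have h := vel_sub_leftLim_eq_impulse_smul_nrm' Φ hz hij hct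
    rw [add_zero, eq_sub_iff_add_eq, ← h]
    abel
  by_cases hpj : p = j
  · subst hpj
    rw [if_neg hpi, if_pos rfl]
    have h := vel_sub_leftLim_right_eq_neg_impulse_smul_nrm Φ hz hij hct
    rw [sub_zero]
    rw [sub_eq_iff_eq_add] at h
    rw [h]
    abel
  · rw [if_neg hpi, if_neg hpj, sub_zero, add_zero]
    exact congrArg Prod.snd ((Φ.isTrajectory z hz).apply_eq_leftLim_apply_of_ne hij
      (flow_mem_contactSet Φ hz t hct) hpi hpj).symm

omit hij hct in
/-- Positions of the left limit are the positions. [folklore] -/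
theorem pos_leftLim_eq (p : Fin (N + 1)) : (leftLim (fun s => Φ.flow s z) t p).1 = (Φ.flow t z p).1 :=
  (Φ.isTrajectory z hz).leftLim_apply_fst (fun _ => continuous_const.add Torus.continuous_proj) t p

omit hij hct in
/-- The mollified density does not jump. [folklore] -/
theorem rhoC_leftLim (r : ℝ) (x : T3) : rhoC r (leftLim (fun s => Φ.flow s z) t) x = rhoC r (Φ.flow t z) x := by
  simp only [rhoC_eq_sum, pos_leftLim_eq Φ hz (t := t)]

/-- Jump of the mollified momentum: `m⁺ - m⁻ = (N+1)⁻¹ (bᵢ - bⱼ) a n̂`. [folklore] -/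
theorem momC_sub_leftLim (r : ℝ) (x : T3) (l : Fin 3) :
    momC r (Φ.flow t z) x l - momC r (leftLim (fun s => Φ.flow s z) t) x l =
      ((N + 1 : ℕ) : ℝ)⁻¹ * (cone r (Φ.flow t z i).1 x - cone r (Φ.flow t z j).1 x) *
        (impulse (hsDiameter σ N) (Φ.flow t z) i j * nrm (hsDiameter σ N) (Φ.flow t z) i j l) := by
  simp only [momC_apply_eq_sum, pos_leftLim_eq Φ hz (t := t), vel_leftLim_eq Φ hz hij hct]
  rw [← mul_sub, ← Finset.sum_sub_distrib, mul_assoc]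
  congr 1
  rw [Fintype.sum_eq_add i j hij]
  · simp only [if_true, if_neg hij, if_neg (Ne.symm hij), PiLp.sub_apply, PiLp.add_apply, PiLp.smul_apply,
      smul_eq_mul, sub_zero, add_zero]
    ring
  · intro p hp
    rw [if_neg hp.1, if_neg hp.2]
    simp

/-- Jump of the mollified kinetic energy: `e⁺ - e⁻ = (N+1)⁻¹ (bᵢ - bⱼ) a ⟨n̂, vᵢ⁺ + vᵢ⁻⟩/2`. [folklore] -/
theorem kinC_sub_leftLim (r : ℝ) (x : T3) :
    kinC r (Φ.flow t z) x - kinC r (leftLim (fun s => Φ.flow s z) t) x =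
      ((N + 1 : ℕ) : ℝ)⁻¹ * (cone r (Φ.flow t z i).1 x - cone r (Φ.flow t z j).1 x) *
        (impulse (hsDiameter σ N) (Φ.flow t z) i j *
          ⟪nrm (hsDiameter σ N) (Φ.flow t z) i j, (Φ.flow t z i).2 + (leftLim (fun s => Φ.flow s z) t i).2⟫_ℝ / 2) := by
  have htraj := Φ.isTrajectory z hz
  have hcs := flow_mem_contactSet Φ hz t hct
  have hE := htraj.norm_sq_vel_add_eq_leftLim hij hcs
  have hother : ∀ p, p ≠ i ∧ p ≠ j → (leftLim (fun s => Φ.flow s z) t p).2 = (Φ.flow t z p).2 := fun p hp =>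
    congrArg Prod.snd (htraj.apply_eq_leftLim_apply_of_ne hij hcs hp.1 hp.2).symm
  have hvi := vel_sub_leftLim_eq_impulse_smul_nrm' Φ hz hij hct
  have hpos := pos_leftLim_eq Φ hz (t := t)
  -- the jump as a particle sum
  have hdiff : kinC r (Φ.flow t z) x - kinC r (leftLim (fun s => Φ.flow s z) t) x =
      ((N + 1 : ℕ) : ℝ)⁻¹ * ∑ p, cone r (Φ.flow t z p).1 x *
        ((‖(Φ.flow t z p).2‖ ^ 2 - ‖(leftLim (fun s => Φ.flow s z) t p).2‖ ^ 2) / 2) := by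
    rw [kinC_eq_sum, kinC_eq_sum, ← mul_sub, ← Finset.sum_sub_distrib]
    congr 1
    refine Finset.sum_congr rfl fun p _ => ?_
    rw [hpos p]
    ring
  rw [hdiff, mul_assoc]
  congr 1
  rw [Fintype.sum_eq_add i j hij]
  · have hj : ‖(Φ.flow t z j).2‖ ^ 2 - ‖(leftLim (fun s => Φ.flow s z) t j).2‖ ^ 2 =
        -(‖(Φ.flow t z i).2‖ ^ 2 - ‖(leftLim (fun s => Φ.flow s z) t i).2‖ ^ 2) := by linarith
    have hi : ‖(Φ.flow t z i).2‖ ^ 2 - ‖(leftLim (fun s => Φ.flow s z) t i).2‖ ^ 2 =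
        impulse (hsDiameter σ N) (Φ.flow t z) i j *
          ⟪nrm (hsDiameter σ N) (Φ.flow t z) i j, (Φ.flow t z i).2 + (leftLim (fun s => Φ.flow s z) t i).2⟫_ℝ := by
      have e : ‖(Φ.flow t z i).2‖ ^ 2 - ‖(leftLim (fun s => Φ.flow s z) t i).2‖ ^ 2 =
          ⟪(Φ.flow t z i).2 - (leftLim (fun s => Φ.flow s z) t i).2,
            (Φ.flow t z i).2 + (leftLim (fun s => Φ.flow s z) t i).2⟫_ℝ := by
        rw [inner_sub_left, inner_add_right, inner_add_right, real_inner_self_eq_norm_sq, real_inner_self_eq_norm_sq,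
          real_inner_comm]
        ring
      rw [e, hvi, inner_smul_left]
      simp
    rw [hj, hi]
    ring
  · intro p hp
    rw [hother p hp]
    ring

end Collision

/-! ## Regularity of the pre-collisional configuration -/

section PreRegular

variable {σ r c η₁ τ : ℝ} (hr : 0 < r) (hc : 0 < c) (Φ : Flow σ N) {z : Phase N} (hR : Regular σ r τ c η₁ Φ z)
  {t : ℝ} (ht : t ∈ Set.Ioc 0 τ)
include hr hc hR ht

omit hc hR ht in
/-- The cone fields at a fixed field point are continuous in the configuration. [folklore] -/
theorem continuous_fields_config (x : T3) :
    (Continuous fun w : Phase N => rhoC r w x) ∧ (Continuous fun w : Phase N => kinC r w x)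
      ∧ ∀ k, Continuous fun w : Phase N => momC r w x k := by
  have hcone : ∀ i : Fin (N + 1), Continuous fun w : Phase N => cone r (w i).1 x := fun i =>
    (lipschitzWith_cone_left hr x).continuous.comp (continuous_fst.comp (continuous_apply i))
  have hvel : ∀ (i : Fin (N + 1)) (k : Fin 3), Continuous fun w : Phase N => (w i).2 k := fun i k =>
    (continuous_apply k).comp ((PiLp.continuous_ofLp 2 _).comp (continuous_snd.comp (continuous_apply i)))
  have hsp : ∀ i : Fin (N + 1), Continuous fun w : Phase N => ‖(w i).2‖ := fun i =>
    (continuous_snd.comp (continuous_apply i)).norm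
  refine ⟨?_, ?_, fun k => ?_⟩
  · simp only [rhoC_eq_sum]
    exact continuous_const.mul (continuous_finsetSum _ fun i _ => hcone i)
  · simp only [kinC_eq_sum]
    exact continuous_const.mul (continuous_finsetSum _ fun i _ => (hcone i).mul (((hsp i).pow 2).div_const 2))
  · simp only [momC_apply_eq_sum]
    exact continuous_const.mul (continuous_finsetSum _ fun i _ => (hcone i).mul (hvel i k))

omit hc hR ht in
/-- The coarse temperature is continuous in the configuration at a configuration of positive density.
[folklore] -/
theorem continuousAt_thetaC_config {w₀ : Phase N} {x : T3} (h0 : rhoC r w₀ x ≠ 0) :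
    ContinuousAt (fun w : Phase N => thetaC r w x) w₀ := by
  obtain ⟨hρ, he, hm⟩ := continuous_fields_config hr x (N := N)
  have hfun : (fun w : Phase N => thetaC r w x) = fun w =>
      2 / 3 * (kinC r w x / rhoC r w x - (∑ k, momC r w x k ^ 2) / (2 * rhoC r w x ^ 2)) := funext fun w => thetaC_eq r w x
  rw [hfun]
  refine continuousAt_const.mul ((he.continuousAt.div hρ.continuousAt h0).sub ?_)
  exact (continuous_finsetSum _ fun k _ => (hm k).pow 2).continuousAt.div
    (continuousAt_const.mul (hρ.continuousAt.pow 2)) (by positivity)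

/-- **The pre-collisional configuration is in the regular range** (positions do not jump; the temperature
floor passes to the left limit). [folklore] -/
theorem regular_leftLim : ∀ x, c ≤ rhoC r (leftLim (fun s => Φ.flow s z) t) x
    ∧ rhoC r (leftLim (fun s => Φ.flow s z) t) x * σ ^ 3 ≤ η₁ ∧ c ≤ thetaC r (leftLim (fun s => Φ.flow s z) t) x := by
  intro x
  have htraj := Φ.isTrajectory z hR.1
  have hpos : ∀ p, (leftLim (fun s => Φ.flow s z) t p).1 = (Φ.flow t z p).1 := fun p => htraj.leftLim_apply_fst (fun _ => continuous_const.add Torus.continuous_proj) t p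
  have hρ : rhoC r (leftLim (fun s => Φ.flow s z) t) x = rhoC r (Φ.flow t z) x := by simp only [rhoC_eq_sum, hpos]
  have hreg := hR.2 t ⟨ht.1.le, ht.2⟩ x
  refine ⟨hρ ▸ hreg.1, hρ ▸ hreg.2.1, ?_⟩
  have hlim : Tendsto (fun s => thetaC r (Φ.flow s z) x) (𝓝[<] t) (𝓝 (thetaC r (leftLim (fun s => Φ.flow s z) t) x)) := by
    have hct := continuousAt_thetaC_config hr (w₀ := leftLim (fun s => Φ.flow s z) t) (x := x)
      (h0 := by rw [hρ]; exact (hc.trans_le hreg.1).ne')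
    exact hct.tendsto.comp (htraj.tendsto_leftLim (fun _ => continuous_const.add Torus.continuous_proj) t)
  refine ge_of_tendsto hlim ?_
  have hnear : ∀ᶠ s in 𝓝[<] t, s ∈ Set.Ioo 0 t := Ioo_mem_nhdsLT ht.1
  filter_upwards [hnear] with s hs
  exact (hR.2 s ⟨hs.1.le, hs.2.le.trans ht.2⟩ x).2.2

end PreRegular

/-! ## The jump of the observable is bounded by the linearisation about the post-collisional state -/

section JumpBound

variable {σ r c η₁ η₀ τ : ℝ} {F : ℝ → ℝ} (hE : EosBand η₀ F) (hη : 0 < η₁) (hη₁ : η₁ < η₀) (hσ : 0 < σ)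
  (hr : 0 < r) (hc : 0 < c) {φ : ℝ → T3 → ℝ} (hφ : Torus.IsSmoothSpaceTimeOn Set.univ φ) (hφ0 : ∀ s x, 0 ≤ φ s x)
  (Φ : Flow σ N) {z : Phase N} (hR : Regular σ r τ c η₁ Φ z) {t : ℝ} (ht : t ∈ Set.Ioc 0 τ)
  {i j : Fin (N + 1)} (hij : i ≠ j)
  (hct : ‖(Torus.geometry (Fin 3)).sepVec (Φ.flow t z i).1 (Φ.flow t z j).1‖ = hsDiameter σ N)

include hr hc hR ht hij hct in
/-- **Convexity bound of the entropy jump at a field point**: `S⁺ - S⁻ ≤ DH(U⁺)·(U⁺ - U⁻)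
= (N+1)⁻¹ (bᵢ - bⱼ) a [n̂·u⁺/θ⁺ - ⟨n̂, vᵢ⁺ + vᵢ⁻⟩/(2θ⁺)]`. [folklore] -/
theorem Hs_sub_Hs_leftLim_le (x : T3) :
    Hs σ (rhoC r (Φ.flow t z) x) (thetaC r (Φ.flow t z) x)
      - Hs σ (rhoC r (leftLim (fun s => Φ.flow s z) t) x) (thetaC r (leftLim (fun s => Φ.flow s z) t) x) ≤
      ((N + 1 : ℕ) : ℝ)⁻¹ * (cone r (Φ.flow t z i).1 x - cone r (Φ.flow t z j).1 x) *
        impulse (hsDiameter σ N) (Φ.flow t z) i j *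
        ((∑ k, uC r (Φ.flow t z) x k * nrm (hsDiameter σ N) (Φ.flow t z) i j k) / thetaC r (Φ.flow t z) x
          - ⟪nrm (hsDiameter σ N) (Φ.flow t z) i j, (Φ.flow t z i).2 + (leftLim (fun s => Φ.flow s z) t i).2⟫_ℝ / 2
            / thetaC r (Φ.flow t z) x) := by
  have hreg := hR.2 t ⟨ht.1.le, ht.2⟩ x
  obtain ⟨hρm, -, hθm⟩ := regular_leftLim hr hc Φ hR ht x
  have hρeq := rhoC_leftLim Φ hR.1 (t := t) r x
  have hρ0 : 0 < rhoC r (Φ.flow t z) x := hc.trans_le hreg.1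
  have hθp : 0 < thetaC r (Φ.flow t z) x := hc.trans_le hreg.2.2
  have hθm' : 0 < thetaC r (leftLim (fun s => Φ.flow s z) t) x := hc.trans_le hθm
  rw [Hs_eq_Hsm hρ0 hθp, Hs_eq_Hsm (hc.trans_le hρm) hθm', hρeq]
  have hconv := Hsm_sub_Hsm_ge (σ := σ) (ρ := rhoC r (Φ.flow t z) x)
    (e₁ := kinC r (leftLim (fun s => Φ.flow s z) t) x) (e₂ := kinC r (Φ.flow t z) x)
    (θ₁ := thetaC r (leftLim (fun s => Φ.flow s z) t) x) (θ₂ := thetaC r (Φ.flow t z) x)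
    (m₁ := fun k => momC r (leftLim (fun s => Φ.flow s z) t) x k) (m₂ := fun k => momC r (Φ.flow t z) x k) hρ0
    (by rw [thetaC_eq, hρeq]) (by rw [thetaC_eq]) hθm' hθp
  have hm : ∀ k, momC r (leftLim (fun s => Φ.flow s z) t) x k = momC r (Φ.flow t z) x k
      - ((N + 1 : ℕ) : ℝ)⁻¹ * (cone r (Φ.flow t z i).1 x - cone r (Φ.flow t z j).1 x) *
        (impulse (hsDiameter σ N) (Φ.flow t z) i j * nrm (hsDiameter σ N) (Φ.flow t z) i j k) := fun k => by
    have h := momC_sub_leftLim Φ hR.1 hij hct r x k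
    linarith
  have he : kinC r (leftLim (fun s => Φ.flow s z) t) x = kinC r (Φ.flow t z) x
      - ((N + 1 : ℕ) : ℝ)⁻¹ * (cone r (Φ.flow t z i).1 x - cone r (Φ.flow t z j).1 x) *
        (impulse (hsDiameter σ N) (Φ.flow t z) i j *
          ⟪nrm (hsDiameter σ N) (Φ.flow t z) i j, (Φ.flow t z i).2 + (leftLim (fun s => Φ.flow s z) t i).2⟫_ℝ / 2) := by
    have h := kinC_sub_leftLim Φ hR.1 hij hct r x
    linarith
  simp only [hm, he, uC_apply] at hconv ⊢
  have hθne : thetaC r (Φ.flow t z) x ≠ 0 := hθp.ne'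
  have hρne : rhoC r (Φ.flow t z) x ≠ 0 := hρ0.ne'
  have key : ((N + 1 : ℕ) : ℝ)⁻¹ * (cone r (Φ.flow t z i).1 x - cone r (Φ.flow t z j).1 x) *
        impulse (hsDiameter σ N) (Φ.flow t z) i j *
        ((∑ k, (rhoC r (Φ.flow t z) x)⁻¹ * momC r (Φ.flow t z) x k * nrm (hsDiameter σ N) (Φ.flow t z) i j k)
            / thetaC r (Φ.flow t z) x
          - ⟪nrm (hsDiameter σ N) (Φ.flow t z) i j, (Φ.flow t z i).2 + (leftLim (fun s => Φ.flow s z) t i).2⟫_ℝ / 2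
            / thetaC r (Φ.flow t z) x) =
      -((∑ k, (rhoC r (Φ.flow t z) x)⁻¹ * momC r (Φ.flow t z) x k / thetaC r (Φ.flow t z) x *
          (momC r (Φ.flow t z) x k - ((N + 1 : ℕ) : ℝ)⁻¹ * (cone r (Φ.flow t z i).1 x - cone r (Φ.flow t z j).1 x) *
            (impulse (hsDiameter σ N) (Φ.flow t z) i j * nrm (hsDiameter σ N) (Φ.flow t z) i j k)
            - momC r (Φ.flow t z) x k))
        - (kinC r (Φ.flow t z) x - ((N + 1 : ℕ) : ℝ)⁻¹ * (cone r (Φ.flow t z i).1 x - cone r (Φ.flow t z j).1 x) *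
            (impulse (hsDiameter σ N) (Φ.flow t z) i j *
              ⟪nrm (hsDiameter σ N) (Φ.flow t z) i j, (Φ.flow t z i).2 + (leftLim (fun s => Φ.flow s z) t i).2⟫_ℝ / 2)
            - kinC r (Φ.flow t z) x) / thetaC r (Φ.flow t z) x) := by
    simp only [Fin.sum_univ_three]
    field_simp
    ring
  rw [key]
  linarith

include hE hη₁ hσ hr hc hφ hφ0 hR ht hij hct in
/-- **The jump of the observable at a collision is at most the linearised jump**:
`F(t, Φₜz) - F(t, Φₜz⁻) ≤ (N+1)⁻¹ a ∫ G (bᵢ - bⱼ)` with `G = (φ/θ⁺)(n̂·u⁺ - ⟨n̂, vᵢ⁺ + vᵢ⁻⟩/2)`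
(convexity at every field point, `φ ≥ 0`). [folklore] -/
theorem collisionJump_obs_le :
    collisionJump (obs σ c η₀ η₁ r φ t) (fun s => Φ.flow s z) t ≤
      ((N + 1 : ℕ) : ℝ)⁻¹ * impulse (hsDiameter σ N) (Φ.flow t z) i j *
        ∫ x, (φ t x / thetaC r (Φ.flow t z) x *
          ((∑ k, uC r (Φ.flow t z) x k * nrm (hsDiameter σ N) (Φ.flow t z) i j k)
            - ⟪nrm (hsDiameter σ N) (Φ.flow t z) i j, (Φ.flow t z i).2 + (leftLim (fun s => Φ.flow s z) t i).2⟫_ℝ / 2))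
          * (cone r (Φ.flow t z i).1 x - cone r (Φ.flow t z j).1 x) := by
  have hregp := hR.2 t ⟨ht.1.le, ht.2⟩
  have hregm := regular_leftLim hr hc Φ hR ht
  have hφt : Continuous (φ t) := (hφ.isSmooth_slice (Set.mem_univ t)).continuous
  have hSp := continuous_Hs_comp hE hη₁ hσ hr hc (Φ.flow t z) hregp
  have hSm := continuous_Hs_comp hE hη₁ hσ hr hc (leftLim (fun s => Φ.flow s z) t) hregm
  have hIp : Integrable (fun x => Hs σ (rhoC r (Φ.flow t z) x) (thetaC r (Φ.flow t z) x) * φ t x) :=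
    integrable_of_continuous_T3 (hSp.mul hφt)
  have hIm : Integrable (fun x => Hs σ (rhoC r (leftLim (fun s => Φ.flow s z) t) x)
      (thetaC r (leftLim (fun s => Φ.flow s z) t) x) * φ t x) := integrable_of_continuous_T3 (hSm.mul hφt)
  unfold collisionJump
  rw [obs_eq hη₁ hc hregp, obs_eq hη₁ hc hregm, ← integral_sub hIp hIm, ← integral_const_mul]
  have hθc := continuous_thetaC hr hc (Φ.flow t z) hregp
  have huc := continuous_uC_apply hr hc (Φ.flow t z) hregp
  have hGc : Continuous fun x => φ t x / thetaC r (Φ.flow t z) x *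
      ((∑ k, uC r (Φ.flow t z) x k * nrm (hsDiameter σ N) (Φ.flow t z) i j k)
        - ⟪nrm (hsDiameter σ N) (Φ.flow t z) i j, (Φ.flow t z i).2 + (leftLim (fun s => Φ.flow s z) t i).2⟫_ℝ / 2) :=
    (hφt.div hθc fun x => (hc.trans_le (hregp x).2.2).ne').mul
      ((continuous_finsetSum _ fun k _ => (huc k).mul continuous_const).sub continuous_const)
  have hbc : Continuous fun x => cone r (Φ.flow t z i).1 x - cone r (Φ.flow t z j).1 x :=
    (continuous_cone r _).sub (continuous_cone r _)
  refine integral_mono (hIp.sub hIm) (integrable_of_continuous_T3 (continuous_const.mul (hGc.mul hbc))) fun x => ?_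
  have hpt := mul_le_mul_of_nonneg_right (Hs_sub_Hs_leftLim_le hr hc Φ hR ht hij hct x) (hφ0 t x)
  have e1 : Hs σ (rhoC r (Φ.flow t z) x) (thetaC r (Φ.flow t z) x) * φ t x
      - Hs σ (rhoC r (leftLim (fun s => Φ.flow s z) t) x) (thetaC r (leftLim (fun s => Φ.flow s z) t) x) * φ t x =
      (Hs σ (rhoC r (Φ.flow t z) x) (thetaC r (Φ.flow t z) x)
        - Hs σ (rhoC r (leftLim (fun s => Φ.flow s z) t) x) (thetaC r (leftLim (fun s => Φ.flow s z) t) x)) * φ t x := by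
    ring
  refine (le_of_eq e1).trans (hpt.trans (le_of_eq ?_))
  simp only [div_eq_mul_inv]
  ring

end JumpBound

end L

/-- **Registered sub-goal `ledgerL_jumpA`** of stub `stub_ledger` (line `exact-entropy-ledger-three-passivities`):
The temperature floor passes to the pre-collisional (left-limit) configuration. [folklore] -/
theorem ledgerL_jumpA :
  ∀ {N : ℕ} {σ r c η₁ τ : ℝ}, 0 < r → 0 < c → ∀ (Φ : Flow σ N) {z : Phase N}, Regular σ r τ c η₁ Φ z → ∀ {t : ℝ}, t ∈ Set.Ioc 0 τ → ∀ x : T3, c ≤ thetaC r (Function.leftLim (fun s => Φ.flow s z) t) x := by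
  intro N σ r c η₁ τ hr hc Φ z hR t ht x
  exact (L.regular_leftLim hr hc Φ hR ht x).2.2

end Summit.AtomisticToContinuum.HydrodynamicLimit.Theorems.LocalSecondLawLedger

end
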